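import Mathlib.Combinatorics.SimpleGraph.Connectivity.Connected
import Mathlib.Data.Sym.Sym2
import Mathlib.Data.Finset.Basic
import HarnessLib

/-!
# Dual BHK inequality — DEFINITIONS: glued structure graphs, support separation, the `EA`/`MASTER` events

Definitions file (`--supports stmt-CriticalPhenomena-4575`; prover prim-ineq-gen-2, gen 6) for the formalisation of the
**dual BHK inequality** `u_b·u_c ≥ t·n′_a`, i.e. `P(ab|c)·P(ac|b) ≥ P(abc)·P(a|b|c ∧ C_a separates b from c in the support)`,
valid on every finite weighted graph (memo `run/shared/lean/prim/prim-ineq-gen-2/DUAL-BHK.md` §8; exact spec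
`EA-MASTER-SPEC.md`).  The proof (files `…DualBHKGraph/Sep/Block/Events/EA/Master/DualBHK`) is an Ahlswede–Daykin
vertex-peeling induction à la van den Berg–Häggström–Kahn for two families of inequalities between events of the GLUED open
cluster of a root `a`; this file only fixes the vocabulary (no named facts, no sorries).

SETTING (the lane's weighted-configuration vocabulary `PrW D p`, configurations `S : Finset (Sym2 V)`, forced edges `F`, open
edge set `O = S ∪ F`).  Everything is computed inside a vertex universe `U : Finset V` (the induction peels vertices of `U`):
* `gl A` — the clique on the vertex set `A` ("`A` is glued into one class"); `og U O` — the open graph (edges of `O` with both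
  ends in `U`); `sG U O A B := og U O ⊔ gl A ⊔ gl B` — the structure graph with hubs `A, B`; the glued class of `a` is its
  `sG`-component (`R(A,B)` of the memo; `R(∅,∅) = C_a`).
* `Kset U O v = {d ∈ U | d ≠ v, s(v,d) ∈ O}` — the open neighbours of the peeled vertex `v`.
* `resG U E W = og U E ⊓ gl W` — the support restricted to `W`; `sepEv U E a P Q ∋ O` — every `P–Q` path of the support
  (trivial paths included) meets the plain open cluster of `a` for the open edges `O` (memo: `Sep(P,Q)`).
* the events (sets of configurations `S`, open set `S ∪ F`):
  `evT U F a M X`   — `t(M,X)`: the `(M,X)`-glued class of `a` meets `M` and `X`;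
  `evXi U F a A Z`  — `Ξ(A;Z)`: the `A`-glued class of `a` meets `A` and misses `Z`;
  `evQp U E F a Av P Q` — `q⁺(Av;P,Q)`: the plain cluster misses `Av` and separates `P` from `Q`;
  `evE2 U E F a M Y N` — the plain cluster meets `M`, misses `Y`, separates `M` from `N` (factor 2 of `EA`);
  `evE4 U F a W M` — the `W`-glued class of `a` meets `W` and `M` (factor 4 of `EA`).
`MASTER(M,M′,𝔐;X,Y,N)`: `t(M,X)·q⁺(M′∪Y;𝔐,N) ≤ Ξ(M∪M′;X∩Y)·Ξ(X∪Y;M∩M′)`;  `EA(M;X,Y,N)`: `t(M,X)·e₂(M;Y,N) ≤ Ξ(M;X∩Y)·e₄(X∪Y;M)`;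
dual BHK = `MASTER({b},{b},{b};{c},{c},{c})`.  [this work; pattern: VandenbergHaggstromKahn2005, §1 (Thm. 1.1)]
-/

namespace Summit.CriticalPhenomena.PercolationContinuityZ3.Theorems

namespace DualBHK

open SimpleGraph

variable {V : Type*}

/-! ### Glue, open graph, structure graph -/

/-- The clique ("glue") on the vertex set `A`: distinct vertices of `A` are adjacent. [this work] -/
def gl (A : Set V) : SimpleGraph V := SimpleGraph.fromRel fun x y => x ∈ A ∧ y ∈ A

/-- Adjacency in the glue graph. [this work] -/
@[simp] theorem gl_adj {A : Set V} {x y : V} : (gl A).Adj x y ↔ x ≠ y ∧ x ∈ A ∧ y ∈ A := by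
  simp only [gl, fromRel_adj, ne_eq]
  tauto

/-- The open graph of the edge set `O` inside the universe `U`: `xy` is an edge iff `s(x,y) ∈ O` and `x, y ∈ U`.
[this work] -/
def og (U : Finset V) (O : Finset (Sym2 V)) : SimpleGraph V :=
  fromEdgeSet {e : Sym2 V | e ∈ O ∧ ∀ z, z ∈ e → z ∈ U}

/-- Adjacency in the open graph. [this work] -/
theorem og_adj {U : Finset V} {O : Finset (Sym2 V)} {x y : V} :
    (og U O).Adj x y ↔ s(x, y) ∈ O ∧ x ∈ U ∧ y ∈ U ∧ x ≠ y := by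
  simp only [og, fromEdgeSet_adj, Set.mem_setOf_eq, Sym2.mem_iff, ne_eq]
  constructor
  · rintro ⟨⟨hO, hU⟩, hne⟩
    exact ⟨hO, hU x (Or.inl rfl), hU y (Or.inr rfl), hne⟩
  · rintro ⟨hO, hx, hy, hne⟩
    refine ⟨⟨hO, fun z hz => ?_⟩, hne⟩
    rcases hz with rfl | rfl
    · exact hx
    · exact hy

/-- The structure graph: open edges inside `U` together with the glue on the hubs `A` and `B`; the glued class of the root
is its connected component in this graph. [this work] -/
def sG (U : Finset V) (O : Finset (Sym2 V)) (A B : Set V) : SimpleGraph V := og U O ⊔ gl A ⊔ gl B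

/-- Adjacency in the structure graph. [this work] -/
theorem sG_adj {U : Finset V} {O : Finset (Sym2 V)} {A B : Set V} {x y : V} :
    (sG U O A B).Adj x y ↔ (og U O).Adj x y ∨ (x ≠ y ∧ x ∈ A ∧ y ∈ A) ∨ (x ≠ y ∧ x ∈ B ∧ y ∈ B) := by
  simp only [sG, sup_adj, gl_adj, or_assoc]

/-- The open neighbours of `v` inside `U ∖ {v}`: `K = {d ∈ U | d ≠ v, s(v,d) ∈ O}` (the set conditioned on when `v` is
peeled). [this work] -/
def Kset (U : Finset V) (O : Finset (Sym2 V)) (v : V) : Set V := {d | d ∈ U ∧ d ≠ v ∧ s(v, d) ∈ O}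

/-- Membership in `Kset`. [this work] -/
@[simp] theorem mem_Kset {U : Finset V} {O : Finset (Sym2 V)} {v d : V} :
    d ∈ Kset U O v ↔ d ∈ U ∧ d ≠ v ∧ s(v, d) ∈ O := Iff.rfl

/-! ### Separation by the open cluster in the support -/

/-- The support graph `og U E` restricted to the vertex set `W` (both ends in `W`). [this work] -/
def resG (U : Finset V) (E : Finset (Sym2 V)) (W : Set V) : SimpleGraph V := og U E ⊓ gl W

/-- Adjacency in the restricted support graph. [this work] -/
theorem resG_adj {U : Finset V} {E : Finset (Sym2 V)} {W : Set V} {x y : V} :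
    (resG U E W).Adj x y ↔ (og U E).Adj x y ∧ x ∈ W ∧ y ∈ W := by
  simp only [resG, inf_adj, gl_adj, ne_eq]
  constructor
  · rintro ⟨h, -, hx, hy⟩; exact ⟨h, hx, hy⟩
  · rintro ⟨h, hx, hy⟩; exact ⟨h, h.ne, hx, hy⟩

/-- `sepEv U E a P Q`: the set of open edge sets `O` for which every `P–Q` path of the support `E` inside `U` (trivial
one-vertex paths included) contains a vertex of the plain open cluster of `a` — i.e. no `p ∈ P`, `q ∈ Q` lie in the
complement `W` of that cluster and are joined by a support path inside `W` (memo: `Sep(P,Q)`). [this work] -/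
def sepEv (U : Finset V) (E : Finset (Sym2 V)) (a : V) (P Q : Set V) : Set (Finset (Sym2 V)) :=
  {O | ∀ p ∈ P, ∀ q ∈ Q, ¬ (¬ (sG U O ∅ ∅).Reachable a p ∧ ¬ (sG U O ∅ ∅).Reachable a q ∧
    (resG U E {z | ¬ (sG U O ∅ ∅).Reachable a z}).Reachable p q)}

/-- Membership in `sepEv`. [this work] -/
theorem mem_sepEv {U : Finset V} {E O : Finset (Sym2 V)} {a : V} {P Q : Set V} :
    O ∈ sepEv U E a P Q ↔ ∀ p ∈ P, ∀ q ∈ Q, ¬ (¬ (sG U O ∅ ∅).Reachable a p ∧ ¬ (sG U O ∅ ∅).Reachable a q ∧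
      (resG U E {z | ¬ (sG U O ∅ ∅).Reachable a z}).Reachable p q) := Iff.rfl

/-! ### The events of the two families (configurations `S`, forced edges `F`, open set `S ∪ F`) -/

section Events

variable [DecidableEq V] (U : Finset V) (E F : Finset (Sym2 V)) (a : V)

/-- `t(M,X)`: with `M` and `X` glued, the class of `a` meets `M` and meets `X`. [this work] -/
def evT (M X : Set V) : Set (Finset (Sym2 V)) :=
  {S | (∃ m ∈ M, (sG U (S ∪ F) M X).Reachable a m) ∧ ∃ x ∈ X, (sG U (S ∪ F) M X).Reachable a x}

/-- `Ξ(A;Z)`: with `A` glued, the class of `a` meets `A` and misses `Z`. [this work] -/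
def evXi (A Z : Set V) : Set (Finset (Sym2 V)) :=
  {S | (∃ m ∈ A, (sG U (S ∪ F) A ∅).Reachable a m) ∧ ∀ z ∈ Z, ¬ (sG U (S ∪ F) A ∅).Reachable a z}

/-- `q⁺(Av;P,Q)`: the plain open cluster of `a` misses `Av` and separates `P` from `Q` in the support `E`. [this work] -/
def evQp (Av P Q : Set V) : Set (Finset (Sym2 V)) :=
  {S | (∀ z ∈ Av, ¬ (sG U (S ∪ F) ∅ ∅).Reachable a z) ∧ S ∪ F ∈ sepEv U E a P Q}

/-- `e₂(M;Y,N)` (factor 2 of `EA`): the plain open cluster of `a` meets `M`, misses `Y`, and separates `M` from `N`.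
[this work] -/
def evE2 (M Y N : Set V) : Set (Finset (Sym2 V)) :=
  {S | (∃ m ∈ M, (sG U (S ∪ F) ∅ ∅).Reachable a m) ∧ (∀ y ∈ Y, ¬ (sG U (S ∪ F) ∅ ∅).Reachable a y) ∧
    S ∪ F ∈ sepEv U E a M N}

/-- `e₄(W;M)` (factor 4 of `EA`): with `W` glued, the class of `a` meets `W` and meets `M`. [this work] -/
def evE4 (W M : Set V) : Set (Finset (Sym2 V)) :=
  {S | (∃ w ∈ W, (sG U (S ∪ F) W ∅).Reachable a w) ∧ ∃ m ∈ M, (sG U (S ∪ F) W ∅).Reachable a m}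

variable {U E F a}

/-- Membership in `evT`. [this work] -/
@[simp] theorem mem_evT {M X : Set V} {S : Finset (Sym2 V)} : S ∈ evT U F a M X ↔
    (∃ m ∈ M, (sG U (S ∪ F) M X).Reachable a m) ∧ ∃ x ∈ X, (sG U (S ∪ F) M X).Reachable a x := Iff.rfl

/-- Membership in `evXi`. [this work] -/
@[simp] theorem mem_evXi {A Z : Set V} {S : Finset (Sym2 V)} : S ∈ evXi U F a A Z ↔
    (∃ m ∈ A, (sG U (S ∪ F) A ∅).Reachable a m) ∧ ∀ z ∈ Z, ¬ (sG U (S ∪ F) A ∅).Reachable a z := Iff.rfl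

/-- Membership in `evQp`. [this work] -/
@[simp] theorem mem_evQp {Av P Q : Set V} {S : Finset (Sym2 V)} : S ∈ evQp U E F a Av P Q ↔
    (∀ z ∈ Av, ¬ (sG U (S ∪ F) ∅ ∅).Reachable a z) ∧ S ∪ F ∈ sepEv U E a P Q := Iff.rfl

/-- Membership in `evE2`. [this work] -/
@[simp] theorem mem_evE2 {M Y N : Set V} {S : Finset (Sym2 V)} : S ∈ evE2 U E F a M Y N ↔
    (∃ m ∈ M, (sG U (S ∪ F) ∅ ∅).Reachable a m) ∧ (∀ y ∈ Y, ¬ (sG U (S ∪ F) ∅ ∅).Reachable a y) ∧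
      S ∪ F ∈ sepEv U E a M N := Iff.rfl

/-- Membership in `evE4`. [this work] -/
@[simp] theorem mem_evE4 {W M : Set V} {S : Finset (Sym2 V)} : S ∈ evE4 U F a W M ↔
    (∃ w ∈ W, (sG U (S ∪ F) W ∅).Reachable a w) ∧ ∃ m ∈ M, (sG U (S ∪ F) W ∅).Reachable a m := Iff.rfl

end Events

end DualBHK

end Summit.CriticalPhenomena.PercolationContinuityZ3.Theorems
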